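import Literature.AlgebraicGeometry.Motives.AbelianVarietyBrauerRelationLatticeRank
import HarnessLib

/-!
# The Brauer relation lattice of `S_3`: `rank K(G) = 1` for `|G| = pq` non-cyclic, and
# `K(S_3) = ℤ · (2C_2 + C_3 − 2S_3 − 1)` — "the unique `S_3`-Brauer relation, up to multiplication by integers" —
# with its Kani–Rosen isogeny `B_{C_2}² × B_{C_3} ∼ X × B_{S_3}²`

Layer A1/A2 of the Hodge foundations lane (`lit-hodgefound`, row A1-20⁺ · A2, seat p03 generation 27, row g27-#4);
sequel of `Motives/AbelianVarietyBrauerRelationLatticeRank` (g27-#1 — CONSUMED by name: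
`finrank_brauerRelations_eq_one_of_forall_ne_top_isCyclic` (rank one when all proper subgroups are cyclic),
`eq_smul_of_mem_of_finrank_eq_one` / `eq_span_singleton_of_finrank_eq_one` (generator criterion for a rank-one lattice),
`mem_ker_linearCombination_indClassFun_one_iff`, `zpowers_map_mulAut_conj`) and of the Kani–Rosen engine of
`Motives/AbelianVarietyBrauerRelationIsogenies` (CONSUMED: `classRelation_of_marks`,
`sum_mul_finrank_hom_image_eq_of_classRelation`, `card_conj_mem_bot`, `indClassFun_top_one` via
`Motives/AbelianVarietyArtinSolomonRelationIsogenies`, `indClassFun_one_apply_eq_div` via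
`Motives/AbelianVarietyInducedBrauerRelations`, `finrank_hom_biprod`, `isIsogenous_iff_forall_finrank_hom_eq'`).
The tree cites the `S_3` example of [DokchitserEtAl2022] in a dozen docstrings ("the term `{1}` of
`Θ = 2C_2 + C_3 − 2S_3 − {1}`", "`Jac_B → E × E × Jac_D`") but never instantiates it; this file works it out for the
concrete group `S_3 = Perm(Fin 3)`, with the finite verifications (conjugacy classes, marks) machine-checked by
`decide`, and adds the general rank statement for groups of order `pq`.  Everything here is PROVED; NO definition,
NO named fact (net Literature debt 0).

## Sources, verbatim

V. Dokchitser, H. Green, A. Konstantinou, A. Morgan, *Parity of ranks of Jacobians of curves* (Proc. LMS 2025;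
arXiv 2211.06357, held `paper:arxiv-2211.06357`, p0004), §1.3: "Recall that a Brauer relation in a finite group `G` is
a formal linear combination of subgroups (up to conjugacy) `Σ_i H_i − Σ_j H_j'`, such that the associated permutation
representations `⊕_i ℂ[G/H_i]` and `⊕_j ℂ[G/H_j']` are isomorphic. Each Brauer relation gives rise to an isogeny
between Jacobians: **Theorem 1.3** ([KaniRosen1989] Theorem 3 …) … For every Brauer relation `Θ = Σ_i H_i − Σ_j H_j'`
for `G`, there is an isogeny `∏_j Jac_{X/H_j'} → ∏_i Jac_{X/H_i}`.  **Example 1.4.** `S_3` has the Brauer relation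
`Θ = 2C_2 + C_3 − 2S_3 − {1}`. This is the unique `S_3`-Brauer relation, up to multiplication by integers. Continuing
Example 1.2, we can apply Theorem 1.3 to get a `K`-isogeny `Jac_B → E × E × Jac_D`."  (Table of Remark 1.5:
`S_3 : 2C_2 + C_3 − 2S_3 − {1}`, `D_{2p} : 2C_2 + C_p − 2D_{2p} − {1}`; "The above Brauer relations are unique, up to
multiplication by integers.")

A. Bartel, T. Dokchitser, *Brauer relations in finite groups*, J. Eur. Math. Soc. **17** (2015) (arXiv 1103.2047, held
`paper:arxiv-1103.2047`), §2 p0006: "the rank of the kernel `K(G)` is the number of conjugacy classes of non-cyclic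
subgroups. […] Example 3. Let `G = C_p × C_p`. All its proper subgroups are cyclic, so `K(G)` has rank one."

## Dictionary and what is proved (namespace `Literature.AlgebraicGeometry.Motives.AbelianVariety`)

`(1_H)^G = indClassFun H 1` (a function `G → ℂ`); the marks `m_H(g) = |{x : x⁻¹gx ∈ H}|` are
`Nat.card {x // x⁻¹ * g * x ∈ H}` (`(1_H)^G = m_H/|H|`, `indClassFun_one_apply_eq_div`); `S_3 = Perm (Fin 3)`,
`C_2 = zpowers (swap 0 1)`, `C_3 = zpowers (finRotate 3)`; the representatives of the four conjugacy classes of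
subgroups are the family `![⊥, C_2, C_3, ⊤] : Fin 4 → Subgroup (Perm (Fin 3))` and `Θ` is the coordinate vector
`![−1, 2, 1, −2] : Fin 4 → ℤ` (no definition is introduced; the literals are repeated); the relation lattice is any
`𝒦 : Submodule ℤ (Fin 4 → ℤ)` with the membership test `h𝒦 : a ∈ 𝒦 ↔ Σ_i a_i (1_{H_i})^{S_3} = 0`, canonically the
kernel of `Fintype.linearCombination`.  For the abelian-variety statements: `ρ : Perm (Fin 3) →* End X`,
`End.of N_H = Σ_{h ∈ H} ρ h`, `B_H = image N_H`, `∼` is `IsIsogenous`.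

* §1 `isCyclic_of_ne_top_of_card_eq_prime_mul_prime` (`|G| = pq` ⟹ proper subgroups cyclic),
  **`finrank_brauerRelations_eq_one_of_card_eq_prime_mul_prime`** (`|G| = pq`, `G` not cyclic ⟹ `rank K(G) = 1`; covers
  `C_p × C_p`, `S_3`, `D_{2p}`).
* §2 (`S_3` concretely) `card_perm_fin_three`, `not_isCyclic_perm_fin_three`, `orderOf_swap_fin_three`,
  `orderOf_finRotate_three`, `natCard_zpowers_swap_fin_three`, `natCard_zpowers_finRotate_three`,
  **`eq_one_or_conj_swap_or_conj_finRotate`** (the three classes), **`card_conj_mem_zpowers_swap`** (`m_{C_2} = 6, 2, 0`),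
  **`card_conj_mem_zpowers_finRotate`** (`m_{C_3} = 6, 0, 6`).
* §3 **`two_smul_indClassFun_swap_add_indClassFun_finRotate`** (`2(1_{C_2})^{S_3} + (1_{C_3})^{S_3} = (1_1)^{S_3} + 2(1_{S_3})^{S_3}`),
  `sum_theta_smul_indClassFun_symmetricThree_eq_zero` (`Σ_i Θ_i (1_{H_i})^{S_3} = 0`).
* §4 `natCard_repr_symmetricThree`, **`repr_symmetricThree_nonconj`**, **`repr_symmetricThree_covers`** (the four
  representatives are pairwise non-conjugate and cover the cyclic subgroups), **`finrank_brauerRelations_symmetricThree`**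
  (`rank K(S_3) = 1`), `theta_mem_brauerRelations_symmetricThree`,
  **`eq_smul_theta_of_mem_brauerRelations_symmetricThree`** (every relation is `a_{C_3} · Θ`),
  **`brauerRelations_symmetricThree_eq_span`** (`K(S_3) = ℤ·Θ`), `ker_linearCombination_indClassFun_one_symmetricThree_eq_span`.
* §5 **`two_mul_finrank_hom_add_finrank_hom_symmetricThree`** (any field:
  `2 rk Hom(B_{C_2}, B) + rk Hom(B_{C_3}, B) = rk Hom(X, B) + 2 rk Hom(B_{S_3}, B)`),
  **`isIsogenous_symmetricThree_theta`** (perfect field: `B_{C_2}² × B_{C_3} ∼ X × B_{S_3}²`),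
  `two_mul_dim_add_dim_symmetricThree` (`2 dim B_{C_2} + dim B_{C_3} = dim X + 2 dim B_{S_3}`).

Scope (stated, not hidden).  (1) "Unique up to multiplication by integers" is formalized as `K(S_3) = ℤ·Θ` for the
lattice of integer vectors on the four class representatives whose permutation characters cancel — Bartel–Dokchitser's
`K(G) = ker(B(G) → char)`; the identification of the Burnside group with `ℤ^{ccs(G)}` is the choice of the family
`![1, C_2, C_3, S_3]`, justified by `repr_symmetricThree_nonconj` / `repr_symmetricThree_covers` (every subgroup of
`S_3` other than `S_3` is cyclic, §1).  (2) The source's route ("as can be checked by an explicit decomposition into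
irreducible characters") is replaced by evaluation of the permutation characters on the three classes (§3) plus the
rank count of g27-#1.  (3) §5 is Kani–Rosen's Theorem 3 for this `Θ` on an abstract abelian variety with `S_3`-action
(for `X = Jac_B` of an `S_3`-cover `B → B/S_3 ≅ ℙ¹` it reads `Jac_B → E × E × Jac_D`; the passage `B_H ∼ Jac_{X/H}`
is not part of this file); `Motives/AbelianVarietyDihedralIdempotentRelations` reaches the same isogeny for an abstract
dihedral group through Theorem B's partition — here the concrete `Perm(Fin 3)` through the character identity, as the
source states it.

## References

* [DokchitserEtAl2022] V. Dokchitser, H. Green, A. Konstantinou, A. Morgan, *Parity of ranks of Jacobians of curves*,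
  Proc. London Math. Soc. (2025), arXiv:2211.06357, §1.3 Thm. 1.3, Example 1.4, Remark 1.5.
* [BartelDokchitser2015] A. Bartel, T. Dokchitser, *Brauer relations in finite groups*, JEMS 17 (2015), §§1.1, 2.
* [KaniRosen1989] E. Kani, M. Rosen, *Idempotent relations and factors of Jacobians*, Math. Ann. 284 (1989), Thm. 3.
-/

noncomputable section

universe u

open CategoryTheory CategoryTheory.Limits Equiv
open Literature.RepresentationTheory.FiniteGroups

namespace Literature.AlgebraicGeometry.Motives

namespace AbelianVariety

/-! ## §1 Groups of order `pq`: all proper subgroups are cyclic, so `rank K(G) = 1` when `G` is not cyclic -/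

section PrimeMulPrime

variable {G : Type} [Group G] {p q : ℕ}

/-- In a group of order `p·q` (`p`, `q` primes, possibly equal) every proper subgroup has order `1`, `p` or `q`, hence is
cyclic ("All its proper subgroups are cyclic" — `C_p × C_p`, `S_3`, `D_{2p}`).
[cite: BartelDokchitser2015, §2 Example 3] [cite: DokchitserEtAl2022, §1.3 Example 1.4] -/
theorem isCyclic_of_ne_top_of_card_eq_prime_mul_prime (hp : p.Prime) (hq : q.Prime) (hcard : Nat.card G = p * q)
    {L : Subgroup G} (hL : L ≠ ⊤) : IsCyclic L := by
  have : Finite G := Nat.finite_of_card_ne_zero (by rw [hcard]; exact Nat.mul_ne_zero hp.ne_zero hq.ne_zero)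
  have hdvd : Nat.card L ∣ p * q := hcard ▸ Subgroup.card_subgroup_dvd_card L
  obtain ⟨d₁, d₂, h₁, h₂, h12⟩ := Nat.dvd_mul.1 hdvd
  have hne : Nat.card L ≠ p * q := fun h ↦ hL (Subgroup.eq_top_of_card_eq L (h.trans hcard.symm))
  rcases (Nat.dvd_prime hp).1 h₁ with hd₁ | hd₁ <;> rcases (Nat.dvd_prime hq).1 h₂ with hd₂ | hd₂ <;>
    rw [hd₁, hd₂] at h12
  · rw [one_mul] at h12
    haveI : Subsingleton L := (Nat.card_eq_one_iff_unique.1 h12.symm).1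
    infer_instance
  · rw [one_mul] at h12
    haveI : Fact q.Prime := ⟨hq⟩
    exact isCyclic_of_prime_card h12.symm
  · rw [mul_one] at h12
    haveI : Fact p.Prime := ⟨hp⟩
    exact isCyclic_of_prime_card h12.symm
  · exact absurd h12.symm hne

variable [Fintype G] {ι : Type} [Fintype ι] (H : ι → Subgroup G) (𝒦 : Submodule ℤ (ι → ℤ))
  (h𝒦 : ∀ a : ι → ℤ, a ∈ 𝒦 ↔ ∑ i, (a i : ℂ) • indClassFun (H i) (1 : H i → ℂ) = 0)
include h𝒦

/-- **`|G| = p·q`, `G` not cyclic (`C_p × C_p`, `S_3`, `D_{2p}`, …) ⟹ `rank K(G) = 1`** for a system of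
representatives of the conjugacy classes of subgroups (pairwise non-conjugate, covering the cyclic subgroups,
containing `G`): the only non-cyclic class is `{G}` ("All its proper subgroups are cyclic, so `K(G)` has rank one";
"the unique `S_3`-Brauer relation, up to multiplication by integers").
[cite: BartelDokchitser2015, §2 (rank of K(G)) and Example 3] [cite: DokchitserEtAl2022, §1.3 Example 1.4] -/
theorem finrank_brauerRelations_eq_one_of_card_eq_prime_mul_prime (hp : p.Prime) (hq : q.Prime)
    (hcard : Nat.card G = p * q) (hG : ¬ IsCyclic G)
    (hrep : ∀ z : G, ∃ i, ∃ x : G, Subgroup.zpowers z = (H i).map (MulAut.conj x).toMonoidHom)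
    (hnc : ∀ i j (x : G), H j = (H i).map (MulAut.conj x).toMonoidHom → i = j) (htop : ∃ i, H i = ⊤) :
    Module.finrank ℤ 𝒦 = 1 :=
  finrank_brauerRelations_eq_one_of_forall_ne_top_isCyclic H 𝒦 h𝒦 hG
    (fun _ hL ↦ isCyclic_of_ne_top_of_card_eq_prime_mul_prime hp hq hcard hL) hrep hnc htop

end PrimeMulPrime

/-! ## §2 `S_3 = Perm(Fin 3)`: the three conjugacy classes, the cyclic subgroups `C_2 = ⟨(0 1)⟩`, `C_3 = ⟨(0 1 2)⟩`
and their marks `m_H(g) = |{x : x⁻¹gx ∈ H}|`, machine-checked -/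

section SymmetricThreeGroup

/-- `|S_3| = 6`. [cite: DokchitserEtAl2022, §1.3 Example 1.4] -/
theorem card_perm_fin_three : Fintype.card (Perm (Fin 3)) = 6 := by decide

/-- `S_3` is not cyclic (it is not even commutative: `(0 1)(1 2) ≠ (1 2)(0 1)`). [cite: DokchitserEtAl2022, §1.3 Example 1.4] -/
theorem not_isCyclic_perm_fin_three : ¬ IsCyclic (Perm (Fin 3)) := fun h ↦ by
  have hc : swap (0 : Fin 3) 1 * swap 1 2 = swap 1 2 * swap 0 1 := IsCyclic.commGroup.mul_comm _ _
  exact absurd hc (by decide)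

/-- `o((0 1)) = 2`. [cite: DokchitserEtAl2022, §1.3 Example 1.4 (C_2 ≤ S_3)] -/
theorem orderOf_swap_fin_three : orderOf (swap (0 : Fin 3) 1) = 2 :=
  haveI : Fact (Nat.Prime 2) := Nat.fact_prime_two
  orderOf_eq_prime (by decide) (by decide)

/-- `o((0 1 2)) = 3`. [cite: DokchitserEtAl2022, §1.3 Example 1.4 (C_3 ≤ S_3)] -/
theorem orderOf_finRotate_three : orderOf (finRotate 3) = 3 :=
  haveI : Fact (Nat.Prime 3) := Nat.fact_prime_three
  orderOf_eq_prime (by decide) (by decide)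

/-- `|C_2| = 2`. [cite: DokchitserEtAl2022, §1.3 Example 1.4] -/
theorem natCard_zpowers_swap_fin_three : Nat.card (Subgroup.zpowers (swap (0 : Fin 3) 1)) = 2 :=
  (Nat.card_zpowers _).trans orderOf_swap_fin_three

/-- `|C_3| = 3`. [cite: DokchitserEtAl2022, §1.3 Example 1.4] -/
theorem natCard_zpowers_finRotate_three : Nat.card (Subgroup.zpowers (finRotate 3)) = 3 :=
  (Nat.card_zpowers _).trans orderOf_finRotate_three

/-- **The three conjugacy classes of `S_3`**: every element is `1`, a conjugate of `(0 1)` or a conjugate of `(0 1 2)`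
(machine-checked). [cite: DokchitserEtAl2022, §1.3 Example 1.4] -/
theorem eq_one_or_conj_swap_or_conj_finRotate (z : Perm (Fin 3)) :
    z = 1 ∨ (∃ x : Perm (Fin 3), x * swap 0 1 * x⁻¹ = z) ∨ (∃ x : Perm (Fin 3), x * finRotate 3 * x⁻¹ = z) := by
  revert z
  decide

/-- In `S_3 ∖ {1}`: `g² = 1` (a transposition) iff `g³ ≠ 1` (not a `3`-cycle). [folklore] -/
private theorem sq_eq_one_iff_not_cube_eq_one {g : Perm (Fin 3)} (hg : g ≠ 1) : g ^ 2 = 1 ↔ ¬ g ^ 3 = 1 := by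
  revert g
  decide

/-- The marks table of `S_3` as filter counts over the powers `(0 1)^k` (`k < 2`) and `(0 1 2)^k` (`k < 3`),
machine-checked: `6, 2, 0` resp. `6, 0, 6` at `g = 1`, a transposition, a `3`-cycle. [folklore] -/
private theorem marks_table_symmetricThree (g : Perm (Fin 3)) :
    ((Finset.univ.filter fun x : Perm (Fin 3) ↦
        x⁻¹ * g * x ∈ (Finset.range 2).image (swap (0 : Fin 3) 1 ^ ·)).card =
      (if g = 1 then 6 else if g ^ 2 = 1 then 2 else 0)) ∧
    ((Finset.univ.filter fun x : Perm (Fin 3) ↦ x⁻¹ * g * x ∈ (Finset.range 3).image (finRotate 3 ^ ·)).card =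
      (if g ^ 3 = 1 then 6 else 0)) := by
  revert g
  decide

/-- `|{x : Q x}|` as the cardinality of a filter by an equivalent decidable predicate. [folklore] -/
private theorem natCard_subtype_eq_card_filter (P : Perm (Fin 3) → Prop) [DecidablePred P]
    (Q : Perm (Fin 3) → Prop) (hQP : ∀ x, Q x ↔ P x) :
    Nat.card {x : Perm (Fin 3) // Q x} = (Finset.univ.filter P).card := by
  rw [← Fintype.card_subtype, ← Nat.card_eq_fintype_card]
  exact Nat.card_congr (Equiv.subtypeEquivRight hQP)

/-- **The marks of `C_2 = ⟨(0 1)⟩`**: `m_{C_2}(1) = 6`, `m_{C_2}(transposition) = 2`, `m_{C_2}(3-cycle) = 0` (so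
`(1_{C_2})^{S_3} = m_{C_2}/2` takes the values `3, 1, 0`). [cite: DokchitserEtAl2022, §1.3 Example 1.4] -/
theorem card_conj_mem_zpowers_swap (g : Perm (Fin 3)) :
    Nat.card {x : Perm (Fin 3) // x⁻¹ * g * x ∈ Subgroup.zpowers (swap (0 : Fin 3) 1)} =
      if g = 1 then 6 else if g ^ 2 = 1 then 2 else 0 := by
  classical
  rw [natCard_subtype_eq_card_filter (fun x ↦ x⁻¹ * g * x ∈ (Finset.range 2).image (swap (0 : Fin 3) 1 ^ ·)) _
    fun x ↦ by rw [mem_zpowers_iff_mem_range_orderOf, orderOf_swap_fin_three]]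
  exact (marks_table_symmetricThree g).1

/-- **The marks of `C_3 = ⟨(0 1 2)⟩`**: `m_{C_3}(1) = 6`, `m_{C_3}(transposition) = 0`, `m_{C_3}(3-cycle) = 6` (so
`(1_{C_3})^{S_3} = m_{C_3}/3` takes the values `2, 0, 2`). [cite: DokchitserEtAl2022, §1.3 Example 1.4] -/
theorem card_conj_mem_zpowers_finRotate (g : Perm (Fin 3)) :
    Nat.card {x : Perm (Fin 3) // x⁻¹ * g * x ∈ Subgroup.zpowers (finRotate 3)} = if g ^ 3 = 1 then 6 else 0 := by
  classical
  rw [natCard_subtype_eq_card_filter (fun x ↦ x⁻¹ * g * x ∈ (Finset.range 3).image (finRotate 3 ^ ·)) _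
    fun x ↦ by rw [mem_zpowers_iff_mem_range_orderOf, orderOf_finRotate_three]]
  exact (marks_table_symmetricThree g).2

end SymmetricThreeGroup

/-! ## §3 The Brauer relation `Θ = 2C_2 + C_3 − 2S_3 − 1` of `S_3` as an identity of permutation characters -/

section SymmetricThreeRelation

/-- **`2·(1_{C_2})^{S_3} + (1_{C_3})^{S_3} = (1_1)^{S_3} + 2·(1_{S_3})^{S_3}`** ("`S_3` has the Brauer relation
`Θ = 2C_2 + C_3 − 2S_3 − {1}`", i.e. `ℚ[S_3/C_2]² ⊕ ℚ[S_3/C_3] ≅ ℚ[S_3] ⊕ ℚ²`), machine-checked on the three classes: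
at `1`: `2·3 + 2 = 6 + 2`; at a transposition: `2·1 + 0 = 0 + 2`; at a `3`-cycle: `2·0 + 2 = 0 + 2`.
[cite: DokchitserEtAl2022, §1.3 Example 1.4] -/
theorem two_smul_indClassFun_swap_add_indClassFun_finRotate :
    (2 : ℂ) • indClassFun (Subgroup.zpowers (swap (0 : Fin 3) 1)) 1 + indClassFun (Subgroup.zpowers (finRotate 3)) 1 =
      indClassFun (⊥ : Subgroup (Perm (Fin 3))) 1 + (2 : ℂ) • indClassFun (⊤ : Subgroup (Perm (Fin 3))) 1 := by
  classical
  funext g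
  simp only [Pi.add_apply, Pi.smul_apply, smul_eq_mul]
  rw [indClassFun_one_apply_eq_div, indClassFun_one_apply_eq_div, indClassFun_one_apply_eq_div (⊥ : Subgroup _),
    indClassFun_top_one, Pi.one_apply, card_conj_mem_zpowers_swap, card_conj_mem_zpowers_finRotate, card_conj_mem_bot,
    natCard_zpowers_swap_fin_three, natCard_zpowers_finRotate_three, Subgroup.card_bot, card_perm_fin_three]
  by_cases h1 : g = 1
  · subst h1
    simp only [if_true, one_pow]
    norm_num
  · by_cases h2 : g ^ 2 = 1
    · have h3 : ¬ g ^ 3 = 1 := (sq_eq_one_iff_not_cube_eq_one h1).1 h2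
      simp only [if_neg h1, if_pos h2, if_neg h3]
      norm_num
    · have h3 : g ^ 3 = 1 := by
        by_contra h3
        exact h2 ((sq_eq_one_iff_not_cube_eq_one h1).2 h3)
      simp only [if_neg h1, if_neg h2, if_pos h3]
      norm_num

/-- The same as a vanishing signed combination over the representatives `![1, C_2, C_3, S_3]` with coefficients
`Θ = ![−1, 2, 1, −2]`: `Σ_i Θ_i (1_{H_i})^{S_3} = 0`. [cite: DokchitserEtAl2022, §1.3 Example 1.4] -/
theorem sum_theta_smul_indClassFun_symmetricThree_eq_zero :
    ∑ i : Fin 4, ((![-1, 2, 1, -2] : Fin 4 → ℤ) i : ℂ) •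
      indClassFun ((![⊥, Subgroup.zpowers (swap (0 : Fin 3) 1), Subgroup.zpowers (finRotate 3), ⊤] :
        Fin 4 → Subgroup (Perm (Fin 3))) i) 1 = 0 := by
  rw [Fin.sum_univ_four]
  show ((-1 : ℤ) : ℂ) • indClassFun (⊥ : Subgroup (Perm (Fin 3))) 1 +
      ((2 : ℤ) : ℂ) • indClassFun (Subgroup.zpowers (swap (0 : Fin 3) 1)) 1 +
      ((1 : ℤ) : ℂ) • indClassFun (Subgroup.zpowers (finRotate 3)) 1 +
      ((-2 : ℤ) : ℂ) • indClassFun (⊤ : Subgroup (Perm (Fin 3))) 1 = 0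
  funext g
  have hg := congr_fun two_smul_indClassFun_swap_add_indClassFun_finRotate g
  simp only [Pi.add_apply, Pi.smul_apply, smul_eq_mul, Pi.zero_apply] at hg ⊢
  push_cast
  linear_combination hg

end SymmetricThreeRelation

/-! ## §4 `K(S_3) = ℤ · Θ`: "the unique `S_3`-Brauer relation, up to multiplication by integers" -/

section SymmetricThreeLattice

/-- The orders `1, 2, 3, 6` of the four representatives `1, C_2, C_3, S_3`. [cite: DokchitserEtAl2022, §1.3 Example 1.4] -/
theorem natCard_repr_symmetricThree (i : Fin 4) :
    Nat.card ((![⊥, Subgroup.zpowers (swap (0 : Fin 3) 1), Subgroup.zpowers (finRotate 3), ⊤] :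
      Fin 4 → Subgroup (Perm (Fin 3))) i) = (![1, 2, 3, 6] : Fin 4 → ℕ) i := by
  fin_cases i
  · exact Subgroup.card_bot
  · exact natCard_zpowers_swap_fin_three
  · exact natCard_zpowers_finRotate_three
  · change Nat.card (⊤ : Subgroup (Perm (Fin 3))) = 6
    rw [Subgroup.card_top, Nat.card_eq_fintype_card, card_perm_fin_three]

/-- **The representatives `1, C_2, C_3, S_3` are pairwise non-conjugate** (their orders `1, 2, 3, 6` differ).
[cite: DokchitserEtAl2022, §1.3 Example 1.4] -/
theorem repr_symmetricThree_nonconj (i j : Fin 4) (x : Perm (Fin 3))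
    (h : (![⊥, Subgroup.zpowers (swap (0 : Fin 3) 1), Subgroup.zpowers (finRotate 3), ⊤] :
        Fin 4 → Subgroup (Perm (Fin 3))) j =
      ((![⊥, Subgroup.zpowers (swap (0 : Fin 3) 1), Subgroup.zpowers (finRotate 3), ⊤] :
        Fin 4 → Subgroup (Perm (Fin 3))) i).map (MulAut.conj x).toMonoidHom) : i = j := by
  have hc := congrArg (fun L : Subgroup (Perm (Fin 3)) ↦ Nat.card L) h
  rw [Subgroup.card_map_of_injective (MulAut.conj x).injective, natCard_repr_symmetricThree,
    natCard_repr_symmetricThree] at hc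
  fin_cases i <;> fin_cases j <;> first | rfl | exact absurd hc (by decide)

/-- **Every cyclic subgroup of `S_3` is conjugate to `1`, `C_2` or `C_3`.** [cite: DokchitserEtAl2022, §1.3 Example 1.4] -/
theorem repr_symmetricThree_covers (z : Perm (Fin 3)) :
    ∃ i : Fin 4, ∃ x : Perm (Fin 3), Subgroup.zpowers z =
      ((![⊥, Subgroup.zpowers (swap (0 : Fin 3) 1), Subgroup.zpowers (finRotate 3), ⊤] :
        Fin 4 → Subgroup (Perm (Fin 3))) i).map (MulAut.conj x).toMonoidHom := by
  rcases eq_one_or_conj_swap_or_conj_finRotate z with rfl | ⟨x, rfl⟩ | ⟨x, rfl⟩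
  · exact ⟨0, 1, by rw [Subgroup.zpowers_one_eq_bot]; exact (Subgroup.map_bot _).symm⟩
  · exact ⟨1, x, (zpowers_map_mulAut_conj x _).symm⟩
  · exact ⟨2, x, (zpowers_map_mulAut_conj x _).symm⟩

variable (𝒦 : Submodule ℤ (Fin 4 → ℤ))
  (h𝒦 : ∀ a : Fin 4 → ℤ, a ∈ 𝒦 ↔
    ∑ i, (a i : ℂ) • indClassFun ((![⊥, Subgroup.zpowers (swap (0 : Fin 3) 1), Subgroup.zpowers (finRotate 3), ⊤] :
      Fin 4 → Subgroup (Perm (Fin 3))) i) 1 = 0)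
include h𝒦

/-- **`rank K(S_3) = 1`.** [cite: DokchitserEtAl2022, §1.3 Example 1.4] [cite: BartelDokchitser2015, §2 (rank of K(G))] -/
theorem finrank_brauerRelations_symmetricThree : Module.finrank ℤ 𝒦 = 1 :=
  finrank_brauerRelations_eq_one_of_card_eq_prime_mul_prime _ 𝒦 h𝒦 Nat.prime_two Nat.prime_three
    (by rw [Nat.card_eq_fintype_card, card_perm_fin_three]) not_isCyclic_perm_fin_three repr_symmetricThree_covers
    repr_symmetricThree_nonconj ⟨3, rfl⟩

/-- **`Θ = 2C_2 + C_3 − 2S_3 − 1 ∈ K(S_3)`** (coordinates `![−1, 2, 1, −2]` on `![1, C_2, C_3, S_3]`).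
[cite: DokchitserEtAl2022, §1.3 Example 1.4] -/
theorem theta_mem_brauerRelations_symmetricThree : (![-1, 2, 1, -2] : Fin 4 → ℤ) ∈ 𝒦 :=
  (h𝒦 _).2 sum_theta_smul_indClassFun_symmetricThree_eq_zero

/-- **"This is the unique `S_3`-Brauer relation, up to multiplication by integers"**: every `a ∈ K(S_3)` is
`a_{C_3} · Θ`. [cite: DokchitserEtAl2022, §1.3 Example 1.4] -/
theorem eq_smul_theta_of_mem_brauerRelations_symmetricThree {a : Fin 4 → ℤ} (ha : a ∈ 𝒦) :
    a = a 2 • (![-1, 2, 1, -2] : Fin 4 → ℤ) :=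
  eq_smul_of_mem_of_finrank_eq_one 𝒦 (finrank_brauerRelations_symmetricThree 𝒦 h𝒦)
    (theta_mem_brauerRelations_symmetricThree 𝒦 h𝒦) rfl ha

/-- **`K(S_3) = ℤ · Θ`.** [cite: DokchitserEtAl2022, §1.3 Example 1.4] -/
theorem brauerRelations_symmetricThree_eq_span : 𝒦 = Submodule.span ℤ {(![-1, 2, 1, -2] : Fin 4 → ℤ)} :=
  eq_span_singleton_of_finrank_eq_one 𝒦 (finrank_brauerRelations_symmetricThree 𝒦 h𝒦)
    (theta_mem_brauerRelations_symmetricThree 𝒦 h𝒦) (k := 2) rfl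

omit h𝒦 in
/-- The canonical lattice: **`K(S_3) = ker(a ↦ Σ_i a_i (1_{H_i})^{S_3}) = ℤ · Θ`** on the representatives
`![1, C_2, C_3, S_3]`. [cite: DokchitserEtAl2022, §1.3 Example 1.4] [cite: BartelDokchitser2015, §1.1 ("Θ ∈ K(G) ⟺ Σ_i n_i Ind 1 = 0")] -/
theorem ker_linearCombination_indClassFun_one_symmetricThree_eq_span :
    LinearMap.ker (Fintype.linearCombination ℤ fun i : Fin 4 ↦
      indClassFun ((![⊥, Subgroup.zpowers (swap (0 : Fin 3) 1), Subgroup.zpowers (finRotate 3), ⊤] :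
        Fin 4 → Subgroup (Perm (Fin 3))) i) 1) =
      Submodule.span ℤ {(![-1, 2, 1, -2] : Fin 4 → ℤ)} :=
  brauerRelations_symmetricThree_eq_span _
    (mem_ker_linearCombination_indClassFun_one_iff
      (![⊥, Subgroup.zpowers (swap (0 : Fin 3) 1), Subgroup.zpowers (finRotate 3), ⊤] :
        Fin 4 → Subgroup (Perm (Fin 3))))

end SymmetricThreeLattice

/-! ## §5 The Kani–Rosen reading of `Θ` for an `S_3`-action: `B_{C_2}² × B_{C_3} ∼ X × B_{S_3}²` -/

section SymmetricThreeIsogeny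

variable {K : Type u} [Field K] {X : AbelianVariety K} (ρ : Perm (Fin 3) →* End X) {N₂ N₃ NG : X ⟶ X}

/-- The marks hypothesis of `Θ`, cleared of denominators (`L = 6`), in the shape of `classRelation_of_marks` with the
two cyclic subgroups as a `Fin 2`-family and `X`, `B_{S_3}` in the slots `c₀, c_G`:
`6 m_{C_2}(g) + 2 m_{C_3}(g) = 6·|S_3|[g = 1] + 2|S_3|` (`48 = 48`, `12 = 12`, `12 = 12`). [folklore] -/
private theorem marks_relation_symmetricThree (g : Perm (Fin 3)) :
    0 * (if g = 1 then Fintype.card (Perm (Fin 3)) else 0) + 0 * Fintype.card (Perm (Fin 3)) +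
        ∑ i, (![6, 2] : Fin 2 → ℕ) i * Nat.card {x : Perm (Fin 3) // x⁻¹ * g * x ∈
          (![Subgroup.zpowers (swap (0 : Fin 3) 1), Subgroup.zpowers (finRotate 3)] :
            Fin 2 → Subgroup (Perm (Fin 3))) i} =
      6 * (if g = 1 then Fintype.card (Perm (Fin 3)) else 0) + 2 * Fintype.card (Perm (Fin 3)) +
        ∑ j, (![] : Fin 0 → ℕ) j * Nat.card {x : Perm (Fin 3) // x⁻¹ * g * x ∈ ((![] : Fin 0 → Subgroup _) j)} := by
  rw [Fin.sum_univ_two, Finset.univ_eq_empty, Finset.sum_empty, zero_mul, zero_mul, zero_add, zero_add, add_zero,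
    card_perm_fin_three]
  show 6 * Nat.card {x : Perm (Fin 3) // x⁻¹ * g * x ∈ Subgroup.zpowers (swap (0 : Fin 3) 1)} +
      2 * Nat.card {x : Perm (Fin 3) // x⁻¹ * g * x ∈ Subgroup.zpowers (finRotate 3)} = _
  rw [card_conj_mem_zpowers_swap, card_conj_mem_zpowers_finRotate]
  by_cases h1 : g = 1
  · subst h1
    simp only [if_true, one_pow]
  · by_cases h2 : g ^ 2 = 1
    · simp only [if_neg h1, if_pos h2, if_neg ((sq_eq_one_iff_not_cube_eq_one h1).1 h2)]
    · have h3 : g ^ 3 = 1 := by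
        by_contra h3
        exact h2 ((sq_eq_one_iff_not_cube_eq_one h1).2 h3)
      simp only [if_neg h1, if_neg h2, if_pos h3]

/-- **Hom counts of `Θ`** (any field): for an abelian variety `X` with an `S_3`-action and every `B`,
**`2 rk Hom(B_{C_2}, B) + rk Hom(B_{C_3}, B) = rk Hom(X, B) + 2 rk Hom(B_{S_3}, B)`** (`B_H = Im N_H`,
`End.of N_H = Σ_{h ∈ H} ρ h`). [cite: KaniRosen1989, Thm. 3] [cite: DokchitserEtAl2022, §1.3 Thm. 1.3 and Example 1.4] -/
theorem two_mul_finrank_hom_add_finrank_hom_symmetricThree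
    (hN₂ : End.of N₂ = ∑ h : Subgroup.zpowers (swap (0 : Fin 3) 1), ρ h)
    (hN₃ : End.of N₃ = ∑ h : Subgroup.zpowers (finRotate 3), ρ h) (hNG : End.of NG = ∑ g, ρ g)
    (B : AbelianVariety K) :
    2 * Module.finrank ℤ (image N₂ ⟶ B) + Module.finrank ℤ (image N₃ ⟶ B) =
      Module.finrank ℤ (X ⟶ B) + 2 * Module.finrank ℤ (image NG ⟶ B) := by
  classical
  have key := sum_mul_finrank_hom_image_eq_of_classRelation ρ
    (![Subgroup.zpowers (swap (0 : Fin 3) 1), Subgroup.zpowers (finRotate 3)] : Fin 2 → Subgroup (Perm (Fin 3)))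
    (![] : Fin 0 → Subgroup (Perm (Fin 3))) (N := ![N₂, N₃]) (N' := ![]) 0 0 ![6, 2] 6 2 ![]
    (classRelation_of_marks _ _ 0 0 _ 6 2 _ marks_relation_symmetricThree)
    (Fin.forall_fin_two.2 ⟨by convert hN₂ <;> rfl, by convert hN₃ <;> rfl⟩) (fun j ↦ j.elim0) hNG B
  rw [Fin.sum_univ_two, Finset.univ_eq_empty, Finset.sum_empty, zero_mul, zero_mul, zero_mul, zero_add, zero_add,
    add_zero, Fintype.card_eq_nat_card, Fintype.card_eq_nat_card, Fintype.card_eq_nat_card] at key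
  have e : 6 * Nat.card (Subgroup.zpowers (swap (0 : Fin 3) 1)) * Module.finrank ℤ (image N₂ ⟶ B) +
      2 * Nat.card (Subgroup.zpowers (finRotate 3)) * Module.finrank ℤ (image N₃ ⟶ B) =
      6 * Module.finrank ℤ (X ⟶ B) + 2 * Nat.card (Perm (Fin 3)) * Module.finrank ℤ (image NG ⟶ B) := key
  rw [natCard_zpowers_swap_fin_three, natCard_zpowers_finRotate_three, Nat.card_eq_fintype_card,
    card_perm_fin_three] at e
  omega

variable [PerfectField K]

/-- **`B_{C_2}² × B_{C_3} ∼ X × B_{S_3}²` for every `S_3`-action on an abelian variety over a perfect field** —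
Kani–Rosen's Theorem 3 applied to `Θ = 2C_2 + C_3 − 2S_3 − 1` ("`Jac_B → E × E × Jac_D`" for an `S_3`-cover);
the abstract dihedral form (`m = 3` of `D_{2m}`, via Theorem B's partition) is in
`Motives/AbelianVarietyDihedralIdempotentRelations`, here the concrete group `Perm(Fin 3)` through the
permutation-character identity of §3. [cite: KaniRosen1989, Thm. 3] [cite: DokchitserEtAl2022, §1.3 Thm. 1.3 and Example 1.4] -/
theorem isIsogenous_symmetricThree_theta
    (hN₂ : End.of N₂ = ∑ h : Subgroup.zpowers (swap (0 : Fin 3) 1), ρ h)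
    (hN₃ : End.of N₃ = ∑ h : Subgroup.zpowers (finRotate 3), ρ h) (hNG : End.of NG = ∑ g, ρ g) :
    IsIsogenous ((image N₂ ⊞ image N₂) ⊞ image N₃) (X ⊞ (image NG ⊞ image NG)) := by
  refine isIsogenous_iff_forall_finrank_hom_eq'.2 fun B ↦ ?_
  rw [finrank_hom_biprod, finrank_hom_biprod, finrank_hom_biprod, finrank_hom_biprod]
  have h := two_mul_finrank_hom_add_finrank_hom_symmetricThree ρ hN₂ hN₃ hNG B
  omega

/-- **Dimensions: `2 dim B_{C_2} + dim B_{C_3} = dim X + 2 dim B_{S_3}`** (for Jacobians of an `S_3`-cover the genus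
formula `2g(C/C_2) + g(C/C_3) = g(C) + 2g(C/S_3)`). [cite: KaniRosen1989, Thm. 3] [cite: DokchitserEtAl2022, §1.3 Example 1.4] -/
theorem two_mul_dim_add_dim_symmetricThree
    (hN₂ : End.of N₂ = ∑ h : Subgroup.zpowers (swap (0 : Fin 3) 1), ρ h)
    (hN₃ : End.of N₃ = ∑ h : Subgroup.zpowers (finRotate 3), ρ h) (hNG : End.of NG = ∑ g, ρ g) :
    2 * (image N₂).dim + (image N₃).dim = X.dim + 2 * (image NG).dim := by
  have hd := (isIsogenous_symmetricThree_theta ρ hN₂ hN₃ hNG).dim_eq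
  rw [dim_biprod, dim_biprod, dim_biprod, dim_biprod] at hd
  omega

end SymmetricThreeIsogeny

end AbelianVariety

end Literature.AlgebraicGeometry.Motives
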